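import Summits.QuantumFields.GaugeBoot.BootstrapDiagonalCutsTable
import HarnessLib

/-!
# A reflection cut family is consistent with the torus bootstrap IFF the Wilson measure is
# reflection positive for it — the general theorem (gauge-boot, L3 ↔ L1)

HONEST FRAMING (cell `pub-gaugeboot`, page 1 of every file): the venture produces certified bounds
on lattice expectations at stated coupling, gauge group, dimension and torus size; NOT a mass gap,
NOT a continuum limit, NOT a string tension; NOT Yang–Mills-summit-bearing (barriers
`FixedCouplingUltralocality`, `PerturbativeInvisibility`). Structural; it certifies no number.
It says which positivity constraints a TORUS bootstrap may impose; nothing else.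

## Content

A lattice bootstrap (Anderson–Kruczenski, Kazakov–Zheng) adds to the Hermitian positivity of the
loop functional REFLECTION-POSITIVITY CUTS `0 ≤ φ ((v ∘ Θ) · v)`, `v` a test function supported in
a half `S` of the lattice, for the reflections `Θ` of the lattice: sites (`x_k ↦ -x_k`), links
(`x_k ↦ 1 - x_k`), diagonals (`x_i ↔ x_j`). The cell typed each family separately
(`BootstrapReflectionPositivity`: site; `BootstrapLinkReflectionPositivity`: link, `β ≥ 0`;
`BootstrapDiagonalCutsTable`: diagonal, the full table). This module states the mechanism ONCE,
for an ARBITRARY continuous self-map `Θ` of the torus configurations and an ARBITRARY link set `S`: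

* `ReflectionPositiveOn μ Θ S` — the packaged statement "`0 ≤ ∫ (F∘Θ)‾ F dμ` for every bounded
  measurable complex `F` with `DependsOn F S`" (the shape of every RP theorem of the cell and of the
  tree's S13); `ReflectionPositiveOn.real` — its real form on continuous observables;
* ★★ `reflectionPositiveOn_iff_poly` — for a `μ`-preserving involution it is decided by POLYNOMIAL
  observables (`rp_of_poly_rp`); `exists_poly_neg_of_not_reflectionPositiveOn`;
* `measurePreserving_of_forall_integral_comp_eq` — invariance of all integrals of measurable real
  functions gives `MeasurePreserving` (how the cell's reflection-invariance theorems are consumed);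
* `rpCutLevelValuesSuN N β Θ S n P` — the level-`n` feasible values of `P` for the `SU(N)` word SDP
  with the cuts `0 ≤ φ ((v∘Θ) · v)`, `v ∈ wordTruncation n`, `DependsOn v S`; the cell's
  `rpLevelValuesSuN` (site), `plainDiagRpLevelValuesSuN` (diagonal) are literally instances
  (`rpLevelValuesSuN_eq`, `plainDiagRpLevelValuesSuN_eq`);
* ★★★ `rpCut_of_bootstrap_suN` / `_uN` — if `μ_Wilson` is RP for `(Θ, S)` and `Θ` maps polynomial
  observables to polynomial observables, EVERY solution of the untruncated bootstrap satisfies every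
  cut; `wilson_mem_rpCutLevelValues_suN`, `rpCutLevelValues_subset_Icc_suN` — the cut SDP is then a
  sound, convergent relaxation;
* ★★★ `rpCutLevelValues_eventually_eq_empty_suN`, `exists_rpCut_neg_of_bootstrap_suN` — if
  `μ_Wilson` is NOT RP for `(Θ, S)` (`Θ` a `μ_Wilson`-preserving, polynomial-stable involution), every
  solution violates a cut and the cut SDP is INFEASIBLE at all large levels, for every objective;
* ★★★ `rpCuts_sound_iff_suN`, `rpCuts_dichotomy_suN` — CONSISTENT IFF REFLECTION POSITIVE; and the
  dichotomy "sound at every level for every observable, or eventually infeasible for every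
  observable" — there is no third behaviour;
* instances: `reflectionPositiveOn_configDiagSwap_iff` (the cell's `DiagonalReflectionPositive`),
  `reflectionPositiveOn_negReflect` (the tree's site RP, every real `β`, even `L`).

The link family at NEGATIVE coupling — where it genuinely fails for `SU(3)` — is the companion
module `BootstrapLinkCutsAllAxes`.

References: K. Osterwalder, E. Seiler, Ann. Phys. 110 (1978) 440 §2; P. D. Anderson, M. Kruczenski,
Nucl. Phys. B 921 (2017) 702 §3; V. Kazakov, Z. Zheng, arXiv:2203.11360 §3.1, §4. Folklore-level;
not in print as theorems as far as the cell's searches go.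
-/

noncomputable section

open MeasureTheory Filter Topology NormedSpace
open scoped ComplexOrder ComplexConjugate
open Literature.MathematicalPhysics.QuantumFieldTheory (LatticeRep Site Edge GaugeConfig wilsonAction
  wilsonMeasure wilsonExpectation isProbabilityMeasure_wilsonMeasure wilsonExpectation_siteReflectionPositive)

namespace Summit.QuantumFields.GaugeBoot

/-! ## Reflection positivity of a measure for a map and a link set -/

section Generic

variable {d L : ℕ} {G : Type*}

/-- **Reflection positivity of `μ` for the map `Θ` on the observables supported in `S`** (packaged
form, as in every RP theorem of the cell): `0 ≤ ∫ conj (F (Θ U)) · F U dμ` — real and non-negative —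
for every bounded measurable complex observable `F` with `DependsOn F S`. [shape] A parametric
definition of a proposition — NOT a fact. [folklore] -/
def ReflectionPositiveOn [MeasurableSpace G] (μ : Measure (GaugeConfig d L G))
    (Θ : GaugeConfig d L G → GaugeConfig d L G) (S : Set (Edge d L)) : Prop :=
  ∀ F : GaugeConfig d L G → ℂ, Measurable F → (∃ C : ℝ, ∀ U, ‖F U‖ ≤ C) → DependsOn F S →
    0 ≤ ∫ U, conj (F (Θ U)) * F U ∂μ

/-- **Invariance of all integrals gives measure preservation**: a measurable self-map `Θ` of a
finite measure space with `∫ F (Θ x) dμ = ∫ F dμ` for every measurable real `F` preserves `μ`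
(indicators). This is how the cell's reflection-invariance theorems
(`cubicTorus_integral_comp_configMidReflect`, …) feed `rp_of_poly_rp`. [folklore] -/
theorem measurePreserving_of_forall_integral_comp_eq {X : Type*} [MeasurableSpace X] {μ : Measure X}
    [IsFiniteMeasure μ] {Θ : X → X} (hΘ : Measurable Θ)
    (h : ∀ F : X → ℝ, Measurable F → ∫ x, F (Θ x) ∂μ = ∫ x, F x ∂μ) : MeasurePreserving Θ μ μ := by
  refine ⟨hΘ, Measure.ext fun A hA => ?_⟩
  rw [Measure.map_apply hΘ hA]
  have h1 := h (A.indicator 1) (measurable_one.indicator hA)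
  have hcomp : (fun x => A.indicator (1 : X → ℝ) (Θ x)) = (Θ ⁻¹' A).indicator 1 := by
    funext x
    rfl
  rw [hcomp, integral_indicator_one (hΘ hA), integral_indicator_one hA] at h1
  exact (ENNReal.toReal_eq_toReal_iff' (measure_ne_top μ _) (measure_ne_top μ _)).1 h1

variable [NeZero L] [Group G] [TopologicalSpace G] [IsTopologicalGroup G] [CompactSpace G] [T2Space G]
  [SecondCountableTopology G] [MeasurableSpace G] [BorelSpace G]

omit [Group G] [IsTopologicalGroup G] [T2Space G] in
/-- **Real form**: if `μ` is RP for `(Θ, S)` then `0 ≤ ∫ f (Θ U) · f U dμ` for every continuous REAL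
observable `f` with `DependsOn f S`. [folklore] -/
theorem ReflectionPositiveOn.real {μ : Measure (GaugeConfig d L G)}
    {Θ : GaugeConfig d L G → GaugeConfig d L G} {S : Set (Edge d L)} (h : ReflectionPositiveOn μ Θ S)
    (f : C(GaugeConfig d L G, ℝ)) (hfS : DependsOn (⇑f) S) :
    0 ≤ ∫ U, f (Θ U) * f U ∂μ := by
  have h' := h (fun U => (f U : ℂ)) (Complex.continuous_ofReal.comp f.continuous).measurable
    ⟨‖f‖, fun U => by simpa using f.norm_coe_le_norm U⟩ (fun U V hUV => by simp only [hfS hUV])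
  simp only [Complex.conj_ofReal, ← Complex.ofReal_mul] at h'
  rw [integral_complex_ofReal] at h'
  exact_mod_cast h'

variable (r : LatticeRep G)

/-- ★★ **Reflection positivity is decided by polynomial observables.** `μ` a probability measure on
the torus configurations preserved by the involution `Θ`, `S` any link set:
`ReflectionPositiveOn μ Θ S` iff `0 ≤ ∫ p (Θ U) · p U dμ` for every POLYNOMIAL observable `p` with
`DependsOn p S` (`rp_of_poly_rp`). [folklore] -/
theorem reflectionPositiveOn_iff_poly (μ : Measure (GaugeConfig d L G)) [IsProbabilityMeasure μ]
    {Θ : GaugeConfig d L G → GaugeConfig d L G} (hΘ : MeasurePreserving Θ μ μ)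
    (hΘΘ : ∀ U, Θ (Θ U) = U) (S : Set (Edge d L)) :
    ReflectionPositiveOn μ Θ S ↔
      ∀ p ∈ polyAlgebra (ι := Edge d L) r, DependsOn (⇑p) S → 0 ≤ ∫ U, p (Θ U) * p U ∂μ :=
  ⟨fun h p _ hpS => h.real p hpS, fun h _ hF hFb hFS => rp_of_poly_rp r μ hΘ hΘΘ S h hF hFb hFS⟩

/-- **A failure of reflection positivity always has a POLYNOMIAL witness** (`Θ` a `μ`-preserving
involution). [folklore] -/
theorem exists_poly_neg_of_not_reflectionPositiveOn (μ : Measure (GaugeConfig d L G))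
    [IsProbabilityMeasure μ] {Θ : GaugeConfig d L G → GaugeConfig d L G}
    (hΘ : MeasurePreserving Θ μ μ) (hΘΘ : ∀ U, Θ (Θ U) = U) {S : Set (Edge d L)}
    (h : ¬ ReflectionPositiveOn μ Θ S) :
    ∃ p ∈ polyAlgebra (ι := Edge d L) r, DependsOn (⇑p) S ∧ ∫ U, p (Θ U) * p U ∂μ < 0 := by
  rw [reflectionPositiveOn_iff_poly r μ hΘ hΘΘ S] at h
  push Not at h
  obtain ⟨p, hp, hpS, hneg⟩ := h
  exact ⟨p, hp, hpS, hneg⟩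

/-! ### Instances: the cell's diagonal statement and the tree's site statement -/

omit [T2Space G] [SecondCountableTopology G] in
/-- **The cell's `DiagonalReflectionPositive r.ρ β i j` is `ReflectionPositiveOn` for the diagonal
swap and the closed diagonal half** (`isDiagonalHalfObservable_iff_dependsOn`). -/
theorem reflectionPositiveOn_configDiagSwap_iff {N : ℕ} (ρ : G →* Matrix (Fin N) (Fin N) ℂ)
    (β : ℝ) (i j : Fin d) :
    ReflectionPositiveOn (wilsonMeasure (d := d) (L := L) ρ β) (configDiagSwap i j)
        (diagHalfLinks (L := L) i j) ↔ DiagonalReflectionPositive (d := d) (L := L) ρ β i j := by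
  refine ⟨fun h F hF hFb hFH => h F hF hFb ((isDiagonalHalfObservable_iff_dependsOn i j F).1 hFH),
    fun h F hF hFb hFS => ?_⟩
  exact h F hF hFb ((isDiagonalHalfObservable_iff_dependsOn i j F).2 hFS)

omit [T2Space G] [SecondCountableTopology G] in
/-- **The tree's site reflection positivity (Osterwalder–Seiler `Θ'`, S13 companion) as an
instance**: on every even torus, at EVERY real `β`, for every continuous unitary `ρ`, the Wilson
measure is RP for `negReflect` on the closed positive half `sitePosEdges ∪ sharedEdges`
(tree `wilsonExpectation_siteReflectionPositive`). -/
theorem reflectionPositiveOn_negReflect [NeZero d] {N : ℕ} (ρ : G →* Matrix (Fin N) (Fin N) ℂ)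
    (hρ : Continuous ρ) (hL : Even L) (β : ℝ) :
    ReflectionPositiveOn (wilsonMeasure (d := d) (L := L) ρ β) GaugeConfig.negReflect
      ((Literature.MathematicalPhysics.QuantumFieldTheory.WilsonSiteRP.sitePosEdges ∪
        Literature.MathematicalPhysics.QuantumFieldTheory.WilsonSiteRP.sharedEdges :
          Finset (Edge d L)) : Set (Edge d L)) :=
  fun F hF hFb hFS => wilsonExpectation_siteReflectionPositive ρ hL hρ β F hF hFb hFS

end Generic

/-! ## The cut family of the `SU(N)` bootstrap attached to `(Θ, S)` -/

section Unitary

open Literature.MathematicalPhysics.QuantumLattice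

variable {d L : ℕ} [NeZero L] (N : ℕ) (β : ℝ)

/-- **The level-`n` feasible values of `P` with the reflection cuts of `(Θ, S)`**: functionals
feasible for the word-length-`n` `SU(N)` bootstrap (normalised, square-positive on level-`n` test
functions, loop equations) with `0 ≤ φ ((v ∘ Θ) · v)` for every level-`n` test function `v`
supported in `S`. [folklore] -/
def rpCutLevelValuesSuN
    (Θ : C(GaugeConfig d L (Matrix.specialUnitaryGroup (Fin N) ℂ),
      GaugeConfig d L (Matrix.specialUnitaryGroup (Fin N) ℂ)))
    (S : Set (Edge d L)) (n : ℕ) (P : C(GaugeConfig d L (Matrix.specialUnitaryGroup (Fin N) ℂ), ℝ)) :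
    Set ℝ :=
  {t | ∃ φ : C(GaugeConfig d L (Matrix.specialUnitaryGroup (Fin N) ℂ), ℝ) →ₗ[ℝ] ℝ,
    IsBootstrapFeasible (fundamentalLatticeRep N) (suExp N)
        (fun _ => wilsonAction (fundamentalRep (Fin N))) β
        (wordTruncation (ι := Edge d L) (fundamentalLatticeRep N) n) φ ∧
      (∀ v ∈ wordTruncation (ι := Edge d L) (fundamentalLatticeRep N) n,
        DependsOn (⇑v) S → 0 ≤ φ (v.comp Θ * v)) ∧
      φ P = t}

variable {N β}
variable {Θ : C(GaugeConfig d L (Matrix.specialUnitaryGroup (Fin N) ℂ),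
  GaugeConfig d L (Matrix.specialUnitaryGroup (Fin N) ℂ))} {S : Set (Edge d L)}

/-- The cell's SITE-RP feasible values `rpLevelValuesSuN` are the instance `Θ = Θ'` (`negReflectCM`),
`S = sitePosEdges ∪ sharedEdges`. -/
theorem rpLevelValuesSuN_eq [NeZero d] (n : ℕ)
    (P : C(GaugeConfig d L (Matrix.specialUnitaryGroup (Fin N) ℂ), ℝ)) :
    rpLevelValuesSuN (d := d) (L := L) N β n P =
      rpCutLevelValuesSuN N β negReflectCM
        ((Literature.MathematicalPhysics.QuantumFieldTheory.WilsonSiteRP.sitePosEdges ∪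
          Literature.MathematicalPhysics.QuantumFieldTheory.WilsonSiteRP.sharedEdges :
            Finset (Edge d L)) : Set (Edge d L)) n P :=
  rfl

/-- The cell's PLAIN DIAGONAL feasible values `plainDiagRpLevelValuesSuN` are the instance
`Θ = Θ_{ij}` (`diagSwapCM`), `S = diagHalfLinks i j`. -/
theorem plainDiagRpLevelValuesSuN_eq (i j : Fin d) (n : ℕ)
    (P : C(GaugeConfig d L (Matrix.specialUnitaryGroup (Fin N) ℂ), ℝ)) :
    plainDiagRpLevelValuesSuN (d := d) (L := L) N β i j n P =
      rpCutLevelValuesSuN N β (diagSwapCM i j) (diagHalfLinks (L := L) i j) n P := by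
  ext t
  simp only [plainDiagRpLevelValuesSuN, rpCutLevelValuesSuN, Set.mem_setOf_eq,
    isDiagonalHalfObservable_iff_dependsOn]

/-- More cuts, fewer feasible functionals. -/
theorem rpCutLevelValues_subset_levelValues (n : ℕ)
    (P : C(GaugeConfig d L (Matrix.specialUnitaryGroup (Fin N) ℂ), ℝ)) :
    rpCutLevelValuesSuN N β Θ S n P ⊆ levelValuesSuN (d := d) (L := L) N β n P := by
  rintro t ⟨φ, hφ, -, rfl⟩
  exact ⟨φ, hφ, rfl⟩

/-- ★★ **The cut SDP bounds converge to the Wilson value** (whatever `Θ`, `S`: cuts only shrink the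
feasible sets, `levelValues_subset_Icc_suN`). [folklore] -/
theorem rpCutLevelValues_subset_Icc_suN {P : C(GaugeConfig d L (Matrix.specialUnitaryGroup (Fin N) ℂ), ℝ)}
    (hP : P ∈ polyAlgebra (ι := Edge d L) (fundamentalLatticeRep N)) {ε : ℝ} (hε : 0 < ε) :
    ∀ᶠ n in atTop, rpCutLevelValuesSuN N β Θ S n P ⊆
      Set.Icc (∫ U, P U ∂(wilsonMeasure (fundamentalRep (Fin N)) β) - ε)
        (∫ U, P U ∂(wilsonMeasure (fundamentalRep (Fin N)) β) + ε) := by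
  filter_upwards [levelValues_subset_Icc_suN N β hP hε] with n hn
  exact (rpCutLevelValues_subset_levelValues n P).trans hn

/-! ### Reflection positive ⇒ the cuts are consequences -/

/-- ★★★ **If the Wilson measure is RP for `(Θ, S)` and `Θ` is polynomial-stable, EVERY solution of
the untruncated `SU(N)` torus bootstrap satisfies every cut**: `0 ≤ φ ((f ∘ Θ) · f)` for
`f ∈ polyAlgebra`, `DependsOn f S` (every solution is the Wilson expectation,
`eq_wilson_of_bootstrap_suN`). [folklore] -/
theorem rpCut_of_bootstrap_suN
    (hRP : ReflectionPositiveOn (wilsonMeasure (d := d) (L := L) (fundamentalRep (Fin N)) β) Θ S)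
    (hΘpoly : ∀ f ∈ polyAlgebra (ι := Edge d L) (fundamentalLatticeRep N),
      f.comp Θ ∈ polyAlgebra (ι := Edge d L) (fundamentalLatticeRep N))
    {φ : C(GaugeConfig d L (Matrix.specialUnitaryGroup (Fin N) ℂ), ℝ) →ₗ[ℝ] ℝ} (h1 : φ 1 = 1)
    (hpos : ∀ a ∈ polyAlgebra (ι := Edge d L) (fundamentalLatticeRep N), 0 ≤ φ (a * a))
    (hφ : IsSDFunctional (fundamentalLatticeRep N) (suExp N) (fun _ => wilsonAction (fundamentalRep (Fin N))) β φ)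
    {f : C(GaugeConfig d L (Matrix.specialUnitaryGroup (Fin N) ℂ), ℝ)}
    (hf : f ∈ polyAlgebra (ι := Edge d L) (fundamentalLatticeRep N)) (hfS : DependsOn (⇑f) S) :
    0 ≤ φ (f.comp Θ * f) := by
  rw [eq_wilson_of_bootstrap_suN N β h1 hpos hφ (Subalgebra.mul_mem _ (hΘpoly f hf) hf)]
  have h := hRP.real f hfS
  simpa only [ContinuousMap.mul_apply, ContinuousMap.comp_apply] using h

/-- ★★★ **`U(N)` version**: if the `U(N)` Wilson measure is RP for `(Θ, S)` and `Θ` is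
polynomial-stable, every solution of the untruncated `U(N)` bootstrap satisfies every cut.
[folklore] -/
theorem rpCut_of_bootstrap_uN
    {Θ : C(GaugeConfig d L (Matrix.unitaryGroup (Fin N) ℂ), GaugeConfig d L (Matrix.unitaryGroup (Fin N) ℂ))}
    (hRP : ReflectionPositiveOn (wilsonMeasure (d := d) (L := L) (unitaryFundamentalRep (Fin N) ℂ) β) Θ S)
    (hΘpoly : ∀ f ∈ polyAlgebra (ι := Edge d L) (unitaryFundamentalLatticeRep N),
      f.comp Θ ∈ polyAlgebra (ι := Edge d L) (unitaryFundamentalLatticeRep N))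
    {φ : C(GaugeConfig d L (Matrix.unitaryGroup (Fin N) ℂ), ℝ) →ₗ[ℝ] ℝ} (h1 : φ 1 = 1)
    (hpos : ∀ a ∈ polyAlgebra (ι := Edge d L) (unitaryFundamentalLatticeRep N), 0 ≤ φ (a * a))
    (hφ : IsSDFunctional (unitaryFundamentalLatticeRep N) (uExp N)
      (fun _ => wilsonAction (unitaryFundamentalRep (Fin N) ℂ)) β φ)
    {f : C(GaugeConfig d L (Matrix.unitaryGroup (Fin N) ℂ), ℝ)}
    (hf : f ∈ polyAlgebra (ι := Edge d L) (unitaryFundamentalLatticeRep N)) (hfS : DependsOn (⇑f) S) :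
    0 ≤ φ (f.comp Θ * f) := by
  rw [eq_wilson_of_bootstrap_uN N β h1 hpos hφ (Subalgebra.mul_mem _ (hΘpoly f hf) hf)]
  have h := hRP.real f hfS
  simpa only [ContinuousMap.mul_apply, ContinuousMap.comp_apply] using h

/-- ★★ **Soundness: if the Wilson measure is RP for `(Θ, S)`, the Wilson value satisfies the cuts at
every level** — the cut SDP is a relaxation containing the true value (no stability hypothesis on
`Θ` is needed here). [folklore] -/
theorem wilson_mem_rpCutLevelValues_suN
    (hRP : ReflectionPositiveOn (wilsonMeasure (d := d) (L := L) (fundamentalRep (Fin N)) β) Θ S) (n : ℕ)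
    (P : C(GaugeConfig d L (Matrix.specialUnitaryGroup (Fin N) ℂ), ℝ)) :
    ∫ U, P U ∂(wilsonMeasure (fundamentalRep (Fin N)) β) ∈ rpCutLevelValuesSuN N β Θ S n P := by
  haveI : IsProbabilityMeasure (wilsonMeasure (d := d) (L := L) (fundamentalRep (Fin N)) β) :=
    isProbabilityMeasure_wilsonMeasure (ρ := fundamentalRep (Fin N)) (continuous_fundamentalRep _) β
  refine ⟨expectationFunctional (wilsonMeasure (fundamentalRep (Fin N)) β),
    isBootstrapFeasible_wilson_suN N β _ rfl (wordTruncation_subset_polyAlgebra _ n),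
    fun v _ hvS => ?_, rfl⟩
  rw [expectationFunctional_apply]
  have h := hRP.real v hvS
  simpa only [ContinuousMap.mul_apply, ContinuousMap.comp_apply] using h

/-! ### Not reflection positive ⇒ the cuts are inconsistent -/

/-- ★★★ **If the Wilson measure is NOT RP for `(Θ, S)`, every solution of the untruncated bootstrap
VIOLATES a cut** (`Θ` a `μ_Wilson`-preserving polynomial-stable involution): some `S`-supported
polynomial `f` has `φ ((f ∘ Θ) · f) < 0`. [folklore] -/
theorem exists_rpCut_neg_of_bootstrap_suN
    (hΘμ : MeasurePreserving Θ (wilsonMeasure (d := d) (L := L) (fundamentalRep (Fin N)) β)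
      (wilsonMeasure (fundamentalRep (Fin N)) β))
    (hΘΘ : ∀ U, Θ (Θ U) = U)
    (hΘpoly : ∀ f ∈ polyAlgebra (ι := Edge d L) (fundamentalLatticeRep N),
      f.comp Θ ∈ polyAlgebra (ι := Edge d L) (fundamentalLatticeRep N))
    (hRP : ¬ ReflectionPositiveOn (wilsonMeasure (d := d) (L := L) (fundamentalRep (Fin N)) β) Θ S)
    {φ : C(GaugeConfig d L (Matrix.specialUnitaryGroup (Fin N) ℂ), ℝ) →ₗ[ℝ] ℝ} (h1 : φ 1 = 1)
    (hpos : ∀ a ∈ polyAlgebra (ι := Edge d L) (fundamentalLatticeRep N), 0 ≤ φ (a * a))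
    (hφ : IsSDFunctional (fundamentalLatticeRep N) (suExp N) (fun _ => wilsonAction (fundamentalRep (Fin N))) β φ) :
    ∃ f ∈ polyAlgebra (ι := Edge d L) (fundamentalLatticeRep N), DependsOn (⇑f) S ∧ φ (f.comp Θ * f) < 0 := by
  haveI : IsProbabilityMeasure (wilsonMeasure (d := d) (L := L) (fundamentalRep (Fin N)) β) :=
    isProbabilityMeasure_wilsonMeasure (ρ := fundamentalRep (Fin N)) (continuous_fundamentalRep _) β
  have hRP' : ¬ ReflectionPositiveOn (wilsonMeasure (d := d) (L := L) (fundamentalLatticeRep N).ρ β) Θ S := hRP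
  obtain ⟨f, hf, hfS, hneg⟩ :=
    exists_poly_neg_of_not_reflectionPositiveOn (fundamentalLatticeRep N) _ hΘμ hΘΘ hRP'
  refine ⟨f, hf, hfS, ?_⟩
  rw [eq_wilson_of_bootstrap_suN N β h1 hpos hφ (Subalgebra.mul_mem _ (hΘpoly f hf) hf)]
  have hneg' : ∫ U, f (Θ U) * f U ∂(wilsonMeasure (fundamentalRep (Fin N)) β) < 0 := hneg
  simpa only [ContinuousMap.mul_apply, ContinuousMap.comp_apply] using hneg'

/-- ★★★ **Inconsistency: if the Wilson measure is NOT RP for `(Θ, S)`, the cut SDP is INFEASIBLE at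
all large levels, for every objective `P`** (`Θ` a `μ_Wilson`-preserving polynomial-stable
involution): a polynomial witness `f` is a level-`n` test function for large `n`, the cut forces
`0 ≤ φ ((f∘Θ) f)` while convergence forces `φ ((f∘Θ) f) → ∫ (f∘Θ) f dμ < 0`. [folklore] -/
theorem rpCutLevelValues_eventually_eq_empty_suN
    (hΘμ : MeasurePreserving Θ (wilsonMeasure (d := d) (L := L) (fundamentalRep (Fin N)) β)
      (wilsonMeasure (fundamentalRep (Fin N)) β))
    (hΘΘ : ∀ U, Θ (Θ U) = U)
    (hΘpoly : ∀ f ∈ polyAlgebra (ι := Edge d L) (fundamentalLatticeRep N),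
      f.comp Θ ∈ polyAlgebra (ι := Edge d L) (fundamentalLatticeRep N))
    (hRP : ¬ ReflectionPositiveOn (wilsonMeasure (d := d) (L := L) (fundamentalRep (Fin N)) β) Θ S)
    (P : C(GaugeConfig d L (Matrix.specialUnitaryGroup (Fin N) ℂ), ℝ)) :
    ∀ᶠ n in atTop, rpCutLevelValuesSuN N β Θ S n P = ∅ := by
  haveI : IsProbabilityMeasure (wilsonMeasure (d := d) (L := L) (fundamentalRep (Fin N)) β) :=
    isProbabilityMeasure_wilsonMeasure (ρ := fundamentalRep (Fin N)) (continuous_fundamentalRep _) β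
  have hRP' : ¬ ReflectionPositiveOn (wilsonMeasure (d := d) (L := L) (fundamentalLatticeRep N).ρ β) Θ S := hRP
  obtain ⟨f, hf, hfS, hneg⟩ :=
    exists_poly_neg_of_not_reflectionPositiveOn (fundamentalLatticeRep N) _ hΘμ hΘΘ hRP'
  have hneg' : ∫ U, f (Θ U) * f U ∂(wilsonMeasure (fundamentalRep (Fin N)) β) < 0 := hneg
  have hQ : f.comp Θ * f ∈ polyAlgebra (ι := Edge d L) (fundamentalLatticeRep N) :=
    Subalgebra.mul_mem _ (hΘpoly f hf) hf
  have hW : ∫ U, (f.comp Θ * f) U ∂(wilsonMeasure (fundamentalRep (Fin N)) β) < 0 := by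
    simpa only [ContinuousMap.mul_apply, ContinuousMap.comp_apply] using hneg'
  filter_upwards [eventually_mem_wordTruncation (fundamentalLatticeRep N) hf,
    bootstrap_convergence_words_suN (d := d) (L := L) N β hQ
      (ε := -(∫ U, (f.comp Θ * f) U ∂(wilsonMeasure (fundamentalRep (Fin N)) β)) / 2)
      (by linarith)] with n hfn hconv
  refine Set.eq_empty_iff_forall_notMem.2 fun t ⟨φ, hφ, hcut, _⟩ => ?_
  have h0 := hcut f hfn hfS
  have h2 := (abs_le.1 (hconv φ hφ)).2
  linarith

/-- ★★★ **CONSISTENT IFF REFLECTION POSITIVE.** `SU(N)` on `(ℤ/L)^d`, any real `β`, `Θ` a continuous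
`μ_Wilson`-preserving polynomial-stable involution, `S` any link set: the Wilson measure is RP for
`(Θ, S)` iff the Wilson value of every observable is feasible with the `(Θ, S)`-cuts at every level.
[folklore] -/
theorem rpCuts_sound_iff_suN
    (hΘμ : MeasurePreserving Θ (wilsonMeasure (d := d) (L := L) (fundamentalRep (Fin N)) β)
      (wilsonMeasure (fundamentalRep (Fin N)) β))
    (hΘΘ : ∀ U, Θ (Θ U) = U)
    (hΘpoly : ∀ f ∈ polyAlgebra (ι := Edge d L) (fundamentalLatticeRep N),
      f.comp Θ ∈ polyAlgebra (ι := Edge d L) (fundamentalLatticeRep N)) :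
    ReflectionPositiveOn (wilsonMeasure (d := d) (L := L) (fundamentalRep (Fin N)) β) Θ S ↔
      ∀ (n : ℕ) (P : C(GaugeConfig d L (Matrix.specialUnitaryGroup (Fin N) ℂ), ℝ)),
        ∫ U, P U ∂(wilsonMeasure (fundamentalRep (Fin N)) β) ∈ rpCutLevelValuesSuN N β Θ S n P := by
  refine ⟨fun h n P => wilson_mem_rpCutLevelValues_suN h n P, fun h => ?_⟩
  by_contra hRP
  obtain ⟨n, hn⟩ := (rpCutLevelValues_eventually_eq_empty_suN hΘμ hΘΘ hΘpoly hRP 1).exists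
  have hmem := h n 1
  rw [hn] at hmem
  exact hmem

/-- ★★★ **The dichotomy**: for such `(Θ, S)` EITHER the cuts are sound at every level for every
observable (RP holds), OR for every observable the cut SDP is infeasible at all large levels (RP
fails) — no reflection cut family is "partially consistent" with a torus bootstrap. [folklore] -/
theorem rpCuts_dichotomy_suN
    (hΘμ : MeasurePreserving Θ (wilsonMeasure (d := d) (L := L) (fundamentalRep (Fin N)) β)
      (wilsonMeasure (fundamentalRep (Fin N)) β))
    (hΘΘ : ∀ U, Θ (Θ U) = U)
    (hΘpoly : ∀ f ∈ polyAlgebra (ι := Edge d L) (fundamentalLatticeRep N),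
      f.comp Θ ∈ polyAlgebra (ι := Edge d L) (fundamentalLatticeRep N)) :
    (∀ (n : ℕ) (P : C(GaugeConfig d L (Matrix.specialUnitaryGroup (Fin N) ℂ), ℝ)),
        ∫ U, P U ∂(wilsonMeasure (fundamentalRep (Fin N)) β) ∈ rpCutLevelValuesSuN N β Θ S n P) ∨
      ∀ P : C(GaugeConfig d L (Matrix.specialUnitaryGroup (Fin N) ℂ), ℝ),
        ∀ᶠ n in atTop, rpCutLevelValuesSuN N β Θ S n P = ∅ := by
  by_cases hRP : ReflectionPositiveOn (wilsonMeasure (d := d) (L := L) (fundamentalRep (Fin N)) β) Θ S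
  · exact Or.inl ((rpCuts_sound_iff_suN hΘμ hΘΘ hΘpoly).1 hRP)
  · exact Or.inr fun P => rpCutLevelValues_eventually_eq_empty_suN hΘμ hΘΘ hΘpoly hRP P

end Unitary

end Summit.QuantumFields.GaugeBoot

end
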